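import Summits.ValiantsHypothesis.ValiantsHypothesis.Theorems.SymPencilPerFourInnerRankPureGramCount

/-!
# Route `SymPencil` — inner rank of the `2 | 2` row split of `per_4`, the pure Gram problem P1:
# the kernel-elimination principle (steps (4)–(5) of the P1 proof, abstract part)
# (`--supports` stmt-ValiantsHypothesis-5674 `SdcSuperquadratic`; (8,8) column; rung currency only)

**Theorem** (`twelve_le_card_of_gram_ker_le`, pure linear algebra).  Let `u_0, …, u_31 ∈ K^ι`
(the generators `n_{bk}, m_{al}` of a pure design) and `⟨x,x'⟩ = Σ_r c_r x_r x'_r`.  The GRAM MAP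
`𝒢 : K^J → K^J`, `z ↦ (Σ_j z_j ⟨u_j, u_j'⟩)_{j'}` factors through `K^ι` (`z ↦ Σ_j z_j u_j ↦ pairings`),
so `rank 𝒢 ≤ |ι|`.  If `ker 𝒢 ≤ ker Θ` for some ONTO linear map `Θ : K³² → K^S`, `|S| = 12` (twelve independent linear
consequences of the kernel equations), then `dim ker 𝒢 ≤ 20`, `rank 𝒢 ≥ 12`, hence `12 ≤ |ι|`
(`false_of_gram_ker_le` with `|ι| ≤ 11`).

USE (blueprint `pub/val-lit/lmr/p8g14-P1/BLUEPRINT-Lean.md`, steps (4)–(5) of the P1 proof of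
`NOTE-p8g14-5674-P1-structure.md`): on the three lines `ν-Gram = c₀^σ` the kernel equations
`N(c₀)x + ½E y = 0`, `½E x + M(c')y = 0` have an `8`-dimensional `x`-freedom (`[N(c₀); E]` has rank `8`)
and their `y`-projection satisfies sixteen explicit equations `L(c') y = 0`, four of which are
independent for every `c'` (two constant rows and the two rows of the first non-vanishing step of the
chain certificate `certchain_σ.json`); `Θ = (those four, eight numeric x-rows)` is onto `K¹²`.
Honest framing: a lemma; the cells `(8,8,10)`, `(8,8,11)` stay open; the window
`27 ≤ sdc(per_4) ≤ 29`, the crux `SdcSuperquadratic` and `VP ≠ VNP` are untouched. No definitions,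
no named facts. [folklore]
-/

noncomputable section

-- single-conjunct layout: Sub = Summit, duplicated namespace component intended
set_option linter.dupNamespace false

namespace Summit.ValiantsHypothesis.ValiantsHypothesis.Theorems.SymPencilPerFourInnerRankPureGramKernel

open Matrix Finset Module

variable {K : Type*} [Field K] {ι : Type*} [Fintype ι]

/-- **Kernel-elimination principle.**  If every `z ∈ K³²` in the kernel of the Gram map of
`u_0,…,u_31` (pairing `Σ_r c_r x_r x'_r`) is killed by an onto linear map `Θ : K³² → K¹²`, then
`12 ≤ |ι|`. [folklore] -/
theorem twelve_le_card_of_gram_ker_le [DecidableEq ι] {S : Type*} [Fintype S] [DecidableEq S]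
    (hS : Fintype.card S = 12) (c : ι → K) {J : Type*} [Fintype J] [DecidableEq J] (u : J → ι → K)
    (Θ : (J → K) →ₗ[K] (S → K)) (hΘ : Function.Surjective Θ)
    (hker : ∀ z : J → K,
      (∀ j' : J, ∑ j, z j * ∑ r, c r * u j r * u j' r = 0) → Θ z = 0) :
    12 ≤ Fintype.card ι := by
  -- `Φ z = Σ_j z_j u_j`, `Ψ v = (⟨v, u_j'⟩)_j'`, `𝒢 = Ψ ∘ Φ`
  let Φ : (J → K) →ₗ[K] (ι → K) :=
    { toFun := fun z r => ∑ j, z j * u j r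
      map_add' := fun z z' => by
        funext r; simp only [Pi.add_apply, add_mul, Finset.sum_add_distrib]
      map_smul' := fun a z => by
        funext r
        simp only [Pi.smul_apply, smul_eq_mul, RingHom.id_apply, Finset.mul_sum]
        exact Finset.sum_congr rfl fun j _ => by ring }
  let Ψ : (ι → K) →ₗ[K] (J → K) :=
    { toFun := fun v j' => ∑ r, c r * v r * u j' r
      map_add' := fun v v' => by
        funext j'; simp only [Pi.add_apply, mul_add, add_mul, Finset.sum_add_distrib]
      map_smul' := fun a v => by
        funext j'
        simp only [Pi.smul_apply, smul_eq_mul, RingHom.id_apply, Finset.mul_sum]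
        exact Finset.sum_congr rfl fun r _ => by ring }
  set 𝒢 : (J → K) →ₗ[K] (J → K) := Ψ.comp Φ with h𝒢
  have h𝒢_apply : ∀ z j', 𝒢 z j' = ∑ j, z j * ∑ r, c r * u j r * u j' r := by
    intro z j'
    show ∑ r, c r * (∑ j, z j * u j r) * u j' r = _
    simp only [Finset.mul_sum, Finset.sum_mul]
    rw [Finset.sum_comm]
    exact Finset.sum_congr rfl fun j _ => Finset.sum_congr rfl fun r _ => by ring
  -- `rank 𝒢 ≤ |ι|`
  have hrange_le : finrank K (LinearMap.range 𝒢) ≤ Fintype.card ι := by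
    calc finrank K (LinearMap.range 𝒢) ≤ finrank K (LinearMap.range Ψ) :=
          Submodule.finrank_mono (LinearMap.range_comp_le_range Φ Ψ)
      _ ≤ finrank K (ι → K) := LinearMap.finrank_range_le Ψ
      _ = Fintype.card ι := finrank_fintype_fun_eq_card K
  -- `ker 𝒢 ≤ ker Θ`, `dim ker Θ = 20`
  have hkerle : LinearMap.ker 𝒢 ≤ LinearMap.ker Θ := by
    intro z hz
    rw [LinearMap.mem_ker] at hz ⊢
    exact hker z fun j' => by rw [← h𝒢_apply, hz, Pi.zero_apply]
  have h𝒢 := LinearMap.finrank_range_add_finrank_ker 𝒢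
  rw [finrank_fintype_fun_eq_card] at h𝒢
  have hΘ' := LinearMap.finrank_range_add_finrank_ker Θ
  rw [LinearMap.range_eq_top.2 hΘ, finrank_top, finrank_fintype_fun_eq_card,
    finrank_fintype_fun_eq_card, hS] at hΘ'
  have hmono := Submodule.finrank_mono hkerle
  omega

/-- **Kernel-elimination principle, contradiction form** (`|ι| ≤ 11`). [folklore] -/
theorem false_of_gram_ker_le [DecidableEq ι] {S : Type*} [Fintype S] [DecidableEq S]
    (hS : Fintype.card S = 12) (hι : Fintype.card ι ≤ 11) (c : ι → K)
    {J : Type*} [Fintype J] [DecidableEq J] (u : J → ι → K)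
    (Θ : (J → K) →ₗ[K] (S → K)) (hΘ : Function.Surjective Θ)
    (hker : ∀ z : J → K,
      (∀ j' : J, ∑ j, z j * ∑ r, c r * u j r * u j' r = 0) → Θ z = 0) : False := by
  have h := twelve_le_card_of_gram_ker_le hS c u Θ hΘ hker
  omega

/-- **Onto from a test family**: a linear map `Θ : K³² → K¹²` whose values at twelve test vectors
form an invertible matrix is onto. [folklore] -/
theorem surjective_of_det_ne_zero {S : Type*} [Fintype S] [DecidableEq S]
    {J : Type*} (Θ : (J → K) →ₗ[K] (S → K)) (w : S → J → K)
    (hdet : (Matrix.of fun s s' : S => Θ (w s') s).det ≠ 0) : Function.Surjective Θ := by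
  have hli : LinearIndependent K (fun s' => Θ (w s')) := by
    have h := Matrix.linearIndependent_cols_of_det_ne_zero hdet
    rw [show (fun s' => Θ (w s')) = (Matrix.of fun s s' : S => Θ (w s') s).col from by
      funext s'; funext s; rfl]
    exact h
  have hspan : Submodule.span K (Set.range fun s' => Θ (w s')) = ⊤ :=
    hli.span_eq_top_of_card_eq_finrank' (by simp)
  rw [← LinearMap.range_eq_top]
  apply le_antisymm le_top
  rw [← hspan, Submodule.span_le]
  rintro _ ⟨s', rfl⟩
  exact LinearMap.mem_range_self Θ (w s')

/-- **Kernel elimination with explicit functionals.**  Twelve linear functionals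
`z ↦ Σ_j a_s j · z j` (`s ∈ S`, `|S| = 12`) that kill the kernel of the Gram map of the generators
`u : J → K^ι`, together with twelve test vectors `v_s'` making `(Σ_j a_s j · v_s' j)` invertible, force
`12 ≤ |ι|`. [folklore] -/
theorem twelve_le_card_of_kernel_functionals [DecidableEq ι] {S : Type*} [Fintype S]
    [DecidableEq S] (hS : Fintype.card S = 12) (c : ι → K) {J : Type*} [Fintype J]
    [DecidableEq J] (u : J → ι → K) (a v : S → J → K)
    (hkill : ∀ z : J → K, (∀ j' : J, ∑ j, z j * ∑ r, c r * u j r * u j' r = 0) →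
      ∀ s, ∑ j, a s j * z j = 0)
    (hdet : (Matrix.of fun s s' : S => ∑ j, a s j * v s' j).det ≠ 0) :
    12 ≤ Fintype.card ι := by
  let Θ : (J → K) →ₗ[K] (S → K) :=
    { toFun := fun z s => ∑ j, a s j * z j
      map_add' := fun z z' => by
        funext s; simp only [Pi.add_apply, mul_add, Finset.sum_add_distrib]
      map_smul' := fun r z => by
        funext s
        simp only [Pi.smul_apply, smul_eq_mul, RingHom.id_apply, Finset.mul_sum]
        exact Finset.sum_congr rfl fun j _ => by ring }
  have hΘ : ∀ z s, Θ z s = ∑ j, a s j * z j := fun z s => rfl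
  refine twelve_le_card_of_gram_ker_le hS c u Θ ?_ ?_
  · refine surjective_of_det_ne_zero Θ v ?_
    rw [show (Matrix.of fun s s' : S => Θ (v s') s) = Matrix.of fun s s' : S => ∑ j, a s j * v s' j
      from by ext s s'; rfl]
    exact hdet
  · intro z hz
    funext s
    rw [hΘ, Pi.zero_apply]
    exact hkill z hz s

/-- **Kernel elimination with explicit functionals, contradiction form** (`|ι| ≤ 11`). [folklore] -/
theorem false_of_kernel_functionals [DecidableEq ι] {S : Type*} [Fintype S] [DecidableEq S]
    (hS : Fintype.card S = 12) (hι : Fintype.card ι ≤ 11) (c : ι → K) {J : Type*} [Fintype J]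
    [DecidableEq J] (u : J → ι → K) (a v : S → J → K)
    (hkill : ∀ z : J → K, (∀ j' : J, ∑ j, z j * ∑ r, c r * u j r * u j' r = 0) →
      ∀ s, ∑ j, a s j * z j = 0)
    (hdet : (Matrix.of fun s s' : S => ∑ j, a s j * v s' j).det ≠ 0) : False := by
  have h := twelve_le_card_of_kernel_functionals hS c u a v hkill hdet
  omega

end Summit.ValiantsHypothesis.ValiantsHypothesis.Theorems.SymPencilPerFourInnerRankPureGramKernel

end
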